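/-
Origin: expansion seat `planner-pub-hodgecm-mc-axioms-1-g15-0`, handover #1 2026-08-20T20:14Z md5 a7d1b13268d5 (NEW; 199 l.; `import Mathlib` only; ns `HodgeCM.Literature.Theta` + `….LiuAlbaneseModuleDatum`; the ABSTRACT Albanese-module datum of [Liu21] §4.2 (`H`, `ρ`, `Char`, `WeightOne`, `Adm`, `Ω`, `PhiMu`; derived `Triple`, `Ωt`, `oscImage`, `block`, `fixedBy`), the cited sentences as `Prop`-valued defs over it (see header), kernel lemmas `triple_eq_of_equiv`, `oscImage_le_block`, `range_le_oscImage`, `block_le`, `mem_fixedBy` [folklore]. CERT lean-direct (1 process, nice 19) on the RUN-61 PKG lib: rc 0 ∕ 7 s ∕ 0 warn ∕ 0 holes `farm/logs/j3v13-lit-1.log`; `#print axioms` 5 ∕ 5 ⊆ trio `farm/logs/j3v13-axioms.log`; NAME LIST: `HodgeCM.Literature.Theta.LiuAlbaneseModuleDatum.triple_eq_of_equiv` · `HodgeCM.Literature.Theta.LiuAlbaneseModuleDatum.oscImage_le_block` · `HodgeCM.Literature.Theta.LiuAlbaneseModuleDatum.block_le`) (`HOME/mc/pub-hodgecm-mc-axioms-1-g15/stage62/HodgeCM/Literature/AlbaneseUnitaryShimuraModules.lean`,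 md5 a7d1b13268d5, 199 lines);
landed by the second packager p2 gen 13 (p2-g13) in gate run 62 as `HodgeCM/Literature/AlbaneseUnitaryShimuraModules.lean` (verbatim).
-/
/-
Copyright (c) 2026 the pub-hodgecm formalisation cell (harness21).  New file, not vendored.
Origin: HOME/mc/pub-hodgecm-mc-axioms-1-g15/lean/J3v13/HodgeCM/Literature/AlbaneseUnitaryShimuraModules.lean — session
planner-pub-hodgecm-mc-axioms-1-g15-0 (unit pub-hodgecm-mc-axioms-1-g15, CONSTRUCTION PROVER gen 15 of lineage mc-axioms-1,
node N-i1 (L-lvl)), 2026-08-20.  (J3) DESIGN PROPOSAL v1.3 (the CM-MINIMAL RE-CUT of record, STATUS l.14280 / l.14286, with the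
v1.3 word l.14319: junction on first entries, CM side by comprehension), Literature half — NOT kitted.  Intended final place (if admitted): `HodgeCM/Literature/AlbaneseUnitaryShimuraModules.lean`
(NEW additive leaf; imports `Mathlib` only; third sibling of the landed `AlbaneseUnitaryShimura.lean` (RUN 25) and
`AlbaneseUnitaryShimuraCM.lean` (RUN 38)).  Companion memo: HOME/mc/pub-hodgecm-mc-axioms-1-g15/J3-DESIGN.md.
-/
import Mathlib

set_option autoImplicit false

/-!
# Cited: [Liu21] Def. 4.11 / Prop. 4.13 / Thm. 4.18 over their REAL carriers — `ℂ[G]`-modules (CM-minimal cut)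

[Liu21] = Yifeng Liu, *Fourier–Jacobi cycles and arithmetic relative trace formula (with an appendix by Chao Li and Yihang Zhu)*,
Cambridge J. Math. **9** (2021), no. 1, 1–147 = arXiv:2102.11518, §4.2 "Albanese of unitary Shimura varieties" (held extraction
`paper:arxiv-2102.11518`, chunks p0019–p0023; author's TeX `FJcycle.tex` ll. 2151–2268) and App. D (chunk p0056).

WHY THIS FILE.  The two landed siblings type Prop. 4.13, Thm. 4.18 (main, (1), (2)), Cor. 4.20 over BARE carriers (index types and
multiplicities in `ℕ`): enough to state them, not enough to USE them at the model, where the sentences must act on actual vector spaces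
(JLIU-THETA-SCOPE §1, J2-STATUS §10.3: «the real-carrier dictionary»).  This file types the printed sentences over Liu's REAL carriers
on the AUTOMORPHIC side — modules over the group algebra `ℂ[G]`, `G = U(𝕍)(𝔸_F^∞)`, compact opens read through any indexed family
`Kof : Lvl → Subgroup G` with a preorder («sufficiently small» = `∃ K₀, ∀ K ≤ K₀`) — and, for Thm. 4.18, whose own carriers
`Ω(μ) = Hom_E(A_∞, A_μ)_ℚ`, `Hom_E(A_K, A_μ)_ℚ` (an Albanese functor, `Hom`-groups of abelian varieties over `E`, `X_K` as an
`E`-scheme) are NOT constructible in this package (binder-2-g17, STATUS l.14280 (i)), ONE COMBINED READING `Thm418Combined`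
stated over an ABSTRACT geometric side (per-level `ℂ`-spaces `W K`, restriction maps `res K : H → W K`, per-level sets of
«CM classes»), which the model instantiates VISIBLY with `H¹` of the identity component `P_Γ` of `X_K ⊗_{E,τ'} ℂ` and the pull-backs
`f^*α`, `f : P_Γ → A_μ ⊗_{E,τ'} ℂ` (`HodgeCM/Model/LiuDictionary.lean`).  GENERIC in `(G, Lvl, Kof, W)`, Mathlib only.  As in the
siblings: carriers are DATA asserted by no one, each cited sentence is ONE `def … : Prop` quoted AS PRINTED with its TYPING note,
readings are LABELLED (desk items r2, r8, r9 of the memo), nothing is proved from them here.  Nothing of PerL / [QW8] / the 2001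
programme is used.

* `LiuAlbaneseModuleDatum G Kof` — carriers: `H = H¹_{B,τ'}(A_∞, ℂ)` as a `ℂ[G]`-module; index data `Char`, `Adm μ`; the modules
  `ω(μ,ε,χ)`; `PhiMu μ` («`τ' ∈ Φ_μ`»).  Derived: `Triple`, `Ωt`, `oscImage t` (sum of the equivariant images of `ω(t)` in `H`),
  `block μ = ⨆_{(ε,χ)} oscImage (μ,ε,χ)` (the `μ`-isotypic block), `fixedBy K M` (`M^K`).
* `Irreducible` [Def. 4.11] · `Prop413` [Prop. 4.13] · `Thm418_2` [Thm. 4.18 (2)] · `MuSeparated` [NOT a §4 sentence; print anchor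
  App. D Lem. D.1 (3); explicit hypothesis, as `hμ` of the sibling's `Prop413.mult_le_one`] · `Thm418Combined` [Thm. 4.18 main
  statement via its proof map (4.3) + Thm. 4.18 (1) + Lem. 2.4 (1), COMBINED READING r8].
-/

noncomputable section

open scoped DirectSum

namespace HodgeCM.Literature.Theta

universe u v w

/-- The `K`-fixed vectors `M^K` of a `ℂ[G]`-module, `K ≤ G`, as a `ℂ`-subspace. [folklore] -/
def fixedBy {G : Type u} [Group G] (K : Subgroup G) (M : Type v) [AddCommGroup M] [Module ℂ M]
    [Module (MonoidAlgebra ℂ G) M] [IsScalarTower ℂ (MonoidAlgebra ℂ G) M] : Submodule ℂ M where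
  carrier := {x | ∀ k ∈ K, (MonoidAlgebra.of ℂ G k) • x = x}
  add_mem' {x y} hx hy k hk := by rw [smul_add, hx k hk, hy k hk]
  zero_mem' k _ := smul_zero _
  smul_mem' c {x} hx k hk := by rw [smul_comm, hx k hk]

/-- (Ported verbatim from the HodgeCMPerL package; no docstring in the source.) -/
theorem mem_fixedBy {G : Type u} [Group G] (K : Subgroup G) {M : Type v} [AddCommGroup M] [Module ℂ M]
    [Module (MonoidAlgebra ℂ G) M] [IsScalarTower ℂ (MonoidAlgebra ℂ G) M] (x : M) :
    x ∈ fixedBy K M ↔ ∀ k ∈ K, (MonoidAlgebra.of ℂ G k) • x = x :=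
  Iff.rfl

/-- **REAL CARRIERS for [Liu21] §4.1–4.2, automorphic side,** at a fixed `(E, F, n, τ')`, `G = U(𝕍)(𝔸_F^∞)` (types only, nothing
asserted; the sibling `LiuAlbaneseDatum`'s carrier docstrings apply word for word):
* `H` — the `ℂ[G]`-module `H¹_{B,τ'}(A_∞, ℂ) := colim_K H¹_{B,τ'}(A_K, ℂ)`, `A_K = Alb(X_K)`, `X_K = Sh(𝕍)_K` (§4.2, chunk p0019 L61–p0020
  L27: "an admissible representation of `U(𝕍)(𝔸_F^∞)`"; by Lem. 2.4 (1) `H¹(A_K) = H¹(X_K)`, so `H = colim_K H¹_{τ'}(X_K, ℂ)` — the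
  form in which the model BUILDS it, from the connected components of the `X_K(ℂ)`);
* `Char` — weight-one conjugate-symplectic automorphic characters `μ` of `𝔸_E^×` (Def. 4.1/4.3); `Adm μ` — the `μ`-admissible `(ε, χ)`
  (Def. 4.11/4.12); `Ω μ a` — `ω(μ,ε,χ) := ⊗'_v ω(μ_v,ε_v,χ_v)` AS A MODULE (Def. 4.11); `PhiMu μ` — "`τ' ∈ Φ_μ`".
[cite: Liu21, §4.2] -/
structure LiuAlbaneseModuleDatum (G : Type u) [Group G] {Lvl : Type v} (Kof : Lvl → Subgroup G) :
    Type (max u v + 1) where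
  /-- `H¹_{B,τ'}(A_∞, ℂ)` -/
  H : Type (max u v)
  [instH₁ : AddCommGroup H]
  [instH₂ : Module ℂ H]
  [instH₃ : Module (MonoidAlgebra ℂ G) H]
  [instH₄ : IsScalarTower ℂ (MonoidAlgebra ℂ G) H]
  /-- weight-one conjugate-symplectic automorphic characters of `𝔸_E^×` -/
  Char : Type (max u v)
  /-- `μ`-admissible completions `(ε, χ)` -/
  Adm : Char → Type (max u v)
  /-- `ω(μ, ε, χ)` -/
  Ω : (μ : Char) → Adm μ → Type (max u v)
  [instΩ₁ : ∀ μ a, AddCommGroup (Ω μ a)]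
  [instΩ₂ : ∀ μ a, Module ℂ (Ω μ a)]
  [instΩ₃ : ∀ μ a, Module (MonoidAlgebra ℂ G) (Ω μ a)]
  [instΩ₄ : ∀ μ a, IsScalarTower ℂ (MonoidAlgebra ℂ G) (Ω μ a)]
  /-- `τ' ∈ Φ_μ` -/
  PhiMu : Char → Prop

attribute [instance] LiuAlbaneseModuleDatum.instH₁ LiuAlbaneseModuleDatum.instH₂ LiuAlbaneseModuleDatum.instH₃
  LiuAlbaneseModuleDatum.instH₄ LiuAlbaneseModuleDatum.instΩ₁ LiuAlbaneseModuleDatum.instΩ₂ LiuAlbaneseModuleDatum.instΩ₃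
  LiuAlbaneseModuleDatum.instΩ₄

namespace LiuAlbaneseModuleDatum

variable {G : Type u} [Group G] {Lvl : Type v} {Kof : Lvl → Subgroup G} (D : LiuAlbaneseModuleDatum G Kof)

/-- The adèlic oscillator triples `(μ, ε, χ)`, `μ` of weight one, `ε` `μ`-admissible (the index set of Prop. 4.13). [folklore] -/
def Triple : Type (max u v) := Σ μ : D.Char, D.Adm μ

/-- (Ported verbatim from the HodgeCMPerL package; no docstring in the source.) -/
instance : DecidableEq D.Triple := Classical.decEq _

/-- `ω(t)` for a triple `t = (μ, (ε,χ))`. [folklore] -/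
abbrev Ωt (t : D.Triple) : Type (max u v) := D.Ω t.1 t.2

/-- The sum of all `ℂ[G]`-equivariant images of `ω(t)` in `H` (the `ω(t)`-isotypic part once Prop. 4.13 holds), as a `ℂ`-subspace. [folklore] -/
def oscImage (t : D.Triple) : Submodule ℂ D.H :=
  ⨆ ψ : D.Ωt t →ₗ[MonoidAlgebra ℂ G] D.H, (LinearMap.range ψ).restrictScalars ℂ

/-- The `μ`-BLOCK of `H`: the sum over the `μ`-admissible `(ε, χ)` of the `ω(μ,ε,χ)`-isotypic parts — by Prop. 4.13 and Thm. 4.18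
(main statement, via (4.3)) this is the image of `Ω(μ) ⊗_{M_μ} ℂ` under (4.3); defined here INTRINSICALLY, so that no carrier of
`Ω(μ)` is needed. [folklore] -/
def block (μ : D.Char) : Submodule ℂ D.H := ⨆ a : D.Adm μ, D.oscImage ⟨μ, a⟩

/-- **[Liu21, Def. 4.11]** (chunk p0020 L38–42), AS PRINTED: "… it makes sense to define the adèlic oscillator representation attached to
`(μ,ε,χ)`, `ω(μ, ε, χ) := ⊗'_v ω(μ_v, ε_v, χ_v)`, which is an irreducible admissible representation of `U(𝕍)(𝔸_F^∞)`."  TYPING: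
irreducible = simple `ℂ[G]`-module; admissibility not typed (unused). [cite: Liu21, Def. 4.11] -/
def Irreducible : Prop := ∀ (μ : D.Char) (a : D.Adm μ), IsSimpleModule (MonoidAlgebra ℂ G) (D.Ω μ a)

/-- **[Liu21, Prop. 4.13]** (chunk p0020 L53–57), AS PRINTED: "Suppose that `n ≥ 3`. Then for every embedding `τ' : E → ℂ`, there is an
isomorphism `H¹_{B,τ'}(A_∞, ℂ) ≅ ⊕_{(μ,ε,χ)} ω(μ, ε, χ)` of `ℂ[U(𝕍)(𝔸_F^∞)]`-modules, where the direct sum is taken over all adèlic oscillator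
triples in which `μ` is of weight one and `ε` is `μ`-admissible."  TYPING (`n ≥ 3` is the instantiator's side condition, `n = 3` at the
model): a `ℂ[G]`-linear isomorphism `H ≃ ⨁_t ω(t)` EXISTS — the displayed sentence, no reading. [cite: Liu21, Prop. 4.13] -/
def Prop413 : Prop := Nonempty (D.H ≃ₗ[MonoidAlgebra ℂ G] ⨁ t : D.Triple, D.Ωt t)

/-- **[Liu21, Thm. 4.18 (2)]** (`FJcycle.tex` l. 2240), AS PRINTED: "The `ℂ[G(𝔸_F^∞)]`-modules in the direct sum in Theorem 4.18 are
mutually non-isomorphic."  TYPING: as the sibling's `LiuAlbaneseDatum.Thm418_2`, over modules. [cite: Liu21, Thm. 4.18 (2)] -/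
def Thm418_2 : Prop :=
  ∀ (μ : D.Char) (a b : D.Adm μ), Nonempty (D.Ω μ a ≃ₗ[MonoidAlgebra ℂ G] D.Ω μ b) → a = b

/-- NOT A §4 SENTENCE (explicit hypothesis, as `hμ` of the sibling's `LiuAlbaneseDatum.Prop413.mult_le_one`): distinct `μ` give
non-isomorphic oscillator modules.  Print anchor: [Liu21, App. D, Lem. D.1 (3)] (chunk p0056 L20–29), AS PRINTED: "If `n ≥ 3`, then
`ω(μ',ε',χ')` is isomorphic to `ω(μ,ε,χ)` if and only if `(μ',ε',χ')=(μ,ε,χ)`" — a LOCAL statement; the global one below follows from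
it at one finite place by restriction to `U(𝕍)(F_v)` and «Hecke characters with equal finite parts are equal» (glue, not typed here). [folklore] -/
def MuSeparated : Prop :=
  ∀ (μ μ' : D.Char) (a : D.Adm μ) (b : D.Adm μ'), Nonempty (D.Ω μ a ≃ₗ[MonoidAlgebra ℂ G] D.Ω μ' b) → μ = μ'

/-- **[Liu21, Thm. 4.18 with its proof map (4.3), Thm. 4.18 (1), Lem. 2.4 (1) — COMBINED READING r8]** (desk item; binder-2-g17
STATUS l.14280 (ii), wording axioms-1-g15 l.14286 / l.14319).  THE PRINTED SOURCES: Thm. 4.18 (`FJcycle.tex` ll. 2232–2237): "Let `μ` be a conjugate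
symplectic automorphic character of `𝔸_E^×` of weight one such that `τ' ∈ Φ_μ`. We have an isomorphism `Ω(μ) ⊗_{M_μ} ℂ ≃ ⊕_ε ⊕_χ ω(μ,ε,χ)`
of `ℂ[G(𝔸_F^∞)]`-modules …", its proof (ll. 2247–2266): the map (4.3) `Ω(μ) ⊗_{M_μ} ℂ → H¹_{B,τ'}(A_∞, ℂ)`, `f ⊗ z ↦ z · f^*α` ("by pulling
back `α`", `α` a basis of the line of `H¹_{B,τ'}(A_μ, ℂ)` on which `M_μ` acts through `M_μ ⊆ ℂ`) is injective and induces the isomorphism;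
Thm. 4.18 (1) (ll. 2238–2239): "For every object `D_μ = (A_μ, i_μ, λ_μ, r_μ) ∈ 𝒜(μ)`, we have a canonical isomorphism
`Ω(μ)^K ≃ Hom_E(A_K, A_μ)_ℚ` for every sufficiently small open compact subgroup `K ⊆ G(𝔸_F^∞)`"; Lem. 2.4 (1) (`FJcycle.tex` l. 1210 `\label{le:albanese}`, §2;
chunk p0011 L42–L45): "Suppose that `k` has characteristic zero. Then (1) for every homomorphism `τ : k → ℂ`, we have a canonical
isomorphism `H¹_{B,τ}(Alb_X, ℚ) ≃ H¹_{B,τ}(X, ℚ)`" (used at `X = X_K`, `A_K = Alb_{X_K}`, `τ = τ'`).  THE READING (a consequence, WEAKER than the print: all `ℂ`-morphisms `P_Γ → A_μ ⊗ ℂ` are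
allowed, a superset of Liu's, and only «⊆ span» is kept): «Let `μ` be of weight one with `τ' ∈ Φ_μ`, `D_μ ∈ 𝒜(μ)`, `α` as above.  There is
a compact open `K₀` such that for every `K ⊆ K₀`, every `K`-fixed vector of the `⊕_{ε,χ} ω(μ,ε,χ)`-isotypic part of `H¹_{B,τ'}(A_∞, ℂ)`
restricts, on the identity connected component `P_K` of `X_K ⊗_{E,τ'} ℂ`, to a `ℂ`-linear combination of the classes `f^*α`,
`f : P_K → A_μ ⊗_{E,τ'} ℂ` a morphism of `ℂ`-schemes.»  DERIVATION (for audit): image (4.3) = the `μ`-isotypic part [Thm. 4.18 via (4.3) +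
multiplicity one, Prop. 4.13] → `(Ω(μ) ⊗_{M_μ} ℂ)^K = Ω(μ)^K ⊗_{M_μ} ℂ` [`G`-equivariance of (4.3); smoothness: `K`-fixed vectors = image of
the averaging idempotent `e_K`, which commutes with `⊗_{M_μ} ℂ`] → `Ω(μ)^K = Hom_E(A_K, A_μ)_ℚ` [Thm. 4.18 (1)] → for such `f`, `f^*α ∈
H¹_{B,τ'}(A_K, ℂ) ⊆ H¹(X_K ⊗_{E,τ'} ℂ, ℂ)` [Lem. 2.4 (1)] and its restriction to `P_K ⊆ X_K ⊗ ℂ` is the pull-back of `α` along the composite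
`ℂ`-morphism `P_K → X_{K,ℂ} → A_{K,ℂ} → A_{μ,ℂ}` [functoriality of Betti `H¹`; the Albanese base point is irrelevant on `H¹`].
TYPING, over an ABSTRACT geometric side supplied by the instantiator: `W K` = `H¹(P_K; ℂ)`, `res K : H → W K` = restriction to `P_K` of
the `K`-fixed vectors (any `ℂ`-linear extension), `cmCl K μ ⊆ W K` ⊇ the set `{f^*α}`: the statement is MONOTONE in `cmCl` (a larger
generator set only weakens «⊆ span»), so any instance whose `cmCl K μ` CONTAINS Liu's generators — `A_μ ⊗_{E,τ'} ℂ` from an object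
`D_μ ∈ 𝒜(μ)` (Def. 4.5; the category is non-empty, Prop. 4.6 (1)) with its `α` — is implied by this reading; the model instantiates `cmCl`
by COMPREHENSION over all CM data admissible for `μ` (v1.3, `Model/LiuDictionary.lean`, contract on `LiuDictionary.adm`), never by a
choice of `A_μ`; "sufficiently small" = `∃ K₀, ∀ K ≤ K₀` (BINDER-TRIAGE §57/§60). [cite: Liu21, Thm. 4.18, Thm. 4.18 (1), (4.3)] -/
def Thm418Combined [Preorder Lvl] {W : Lvl → Type w} [∀ K, AddCommGroup (W K)] [∀ K, Module ℂ (W K)]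
    (res : ∀ K : Lvl, D.H →ₗ[ℂ] W K) (cmCl : ∀ K : Lvl, D.Char → Set (W K)) : Prop :=
  ∀ μ : D.Char, D.PhiMu μ → ∃ K₀ : Lvl, ∀ K ≤ K₀, ∀ x ∈ D.block μ, x ∈ fixedBy (Kof K) D.H →
    res K x ∈ Submodule.span ℂ (cmCl K μ)

variable {D}

/-- Triples with isomorphic `ω` are equal (Thm. 4.18 (2) + `MuSeparated`). [folklore] -/
theorem triple_eq_of_equiv (h2 : D.Thm418_2) (hμ : D.MuSeparated) (t t' : D.Triple)
    (h : Nonempty (D.Ωt t ≃ₗ[MonoidAlgebra ℂ G] D.Ωt t')) : t = t' := by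
  obtain ⟨μ, a⟩ := t
  obtain ⟨μ', b⟩ := t'
  obtain rfl : μ = μ' := hμ μ μ' a b h
  obtain rfl : a = b := h2 μ a b h
  rfl

/-- `oscImage t ≤ block μ_t`. [folklore] -/
theorem oscImage_le_block (t : D.Triple) : D.oscImage t ≤ D.block t.1 :=
  le_iSup (fun a : D.Adm t.1 => D.oscImage ⟨t.1, a⟩) t.2

/-- The range of a `ℂ[G]`-map `ω(t) → H` lies in `oscImage t`. [folklore] -/
theorem range_le_oscImage (t : D.Triple) (ψ : D.Ωt t →ₗ[MonoidAlgebra ℂ G] D.H) :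
    (LinearMap.range ψ).restrictScalars ℂ ≤ D.oscImage t :=
  le_iSup (fun ψ : D.Ωt t →ₗ[MonoidAlgebra ℂ G] D.H => (LinearMap.range ψ).restrictScalars ℂ) ψ

/-- `block μ ≤ N` as soon as `N` contains the range of every `ℂ[G]`-map `ω(μ,ε,χ) → H`. [folklore] -/
theorem block_le {μ : D.Char} {N : Submodule ℂ D.H}
    (h : ∀ (a : D.Adm μ) (ψ : D.Ωt ⟨μ, a⟩ →ₗ[MonoidAlgebra ℂ G] D.H), (LinearMap.range ψ).restrictScalars ℂ ≤ N) :
    D.block μ ≤ N :=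
  iSup_le fun a => iSup_le fun ψ => h a ψ

end LiuAlbaneseModuleDatum

end HodgeCM.Literature.Theta

end
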